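import Literature.MathematicalPhysics.QuantumFieldTheory.Balaban1983to89.B5Eq117TorusBridge
import Literature.MathematicalPhysics.QuantumFieldTheory.Balaban1983to89.B5HkOpLandauMin
import Literature.MathematicalPhysics.QuantumFieldTheory.Balaban1983to89.B5Eq164LandauV1

/-!
# `Balaban1983to89.B5Eq147TorusBridge` — T. Bałaban, *Propagators and renormalization transformations for lattice gauge
theories. I*, Commun. Math. Phys. **95** (1984) 17–40 [Balaban1984PropagatorsI], (1.21) p. 21, (1.46)–(1.47) p. 26, (1.58)–(1.64)
pp. 28–29, with T. Bałaban, J. Imbrie, A. Jaffe, *Renormalization of the Higgs model: minimizers, propagators and the stability of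
mean field theory*, Commun. Math. Phys. **97** (1985) 299–329 [BalabanImbrieJaffe1985], (4.4.2) p. 312: ONE Landau gauge, ONE
minimiser `H_k`, ONE integral (1.47) — TWO formalizations.  KNITTING of the V1 lattice calculus (seats p11 `BIJ85LandauMinimizer442V1`,
p38 `B5Eq164LandauV1`) with the B5 owner's torus tower (r02 `B5SectBStatements`, p21 `B5TowerOneStroke`, this seat's gen 2
`B5Eq147Landau` / `B5HkOpLandauMin`): the Landau subspace `{A : R∂*A = 0}`, the Faddeev–Popov mean (4.4.2) versus the closed-form
operator (1.63), and the Landau-gauge integral (1.47), under the isometric reindexing `T^{(0)} ≃ Tor (towerM L Mk k)` of gen 3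
(`B5Eq117TorusCarriers`)

statement-level skeleton of published theorems with citation tags; proofs where landed; nothing here is a claim about the Yang–Mills mass gap

PDF held: `paper:balaban1984-cmp95-propagators-rt-i` (journal page = PDF page + 16; pp. 21, 25, 26, 28, 29 [PDF 5, 9, 10, 12, 13]
read from the materialised text `~/.lit/texts/paper-balaban1984-cmp95-propagators-rt-i/p0005.txt … p0013.txt`);
`paper:balaban1985-cmp97-bij-higgs-minimizers` (journal page = PDF page + 298; p. 312 [PDF 14], `p0014.txt`).

PRINT, verbatim.  [B5] p. 21 [PDF 5] l. 7, after (1.21): «where Δ is η-lattice Laplace operator for scalar functions and ∂* is the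
divergence operator for vector functions, ∂*A = Σ_μ ∂*_μA_μ.»  p. 25 [PDF 9] ll. 2–4: «The projection operator R has a clear meaning.
It is an orthogonal projection on the linear subspace ΔN(Q′_k) of L²(T_η), N(Q′_k) = {λ : Q′_kλ = 0}. Indeed RΔλ = Δλ if Q′_kλ = 0.»
p. 26 [PDF 10] ll. 13–22: «In the sequel it will be convenient to take the limit α → 0, i.e. to consider Landau gauge. … We have to
calculate the integral ((ST)^k e^{−S})(B) = z′^{(k)}|det(Δ↾_{N(Q′_k)})|∫dA δ(B − Q_kA)δ_R(∂*A) exp(−½⟨∂A, ∂A⟩). (1.47) With this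
integral an operator of fundamental importance is connected. It is defined on configurations B on the lattice T₁^{(k)} and its
value on such a configuration is equal to a configuration A on T_η minimizing the form ½⟨∂A, ∂A⟩ under the conditions Q_kA = B,
R∂*A = 0.»  p. 28 [PDF 12] l. 4: «This defines the operator H_kB = A».  p. 29 [PDF 13] ll. 4–10: «Using (1.60), or better (1.63),
we can verify all the properties of H_kB: Q_kH_kB = B, R∂*H_kB = 0, H_kB is a minimum of ½⟨∂A, ∂A⟩ on the hyperplane {A : Q_kA = B,
R∂*A = 0} … Let us now come back to the integral (1.47). We make the translation A = A′ + H_kB and using the above properties of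
H_kB, we get (1.47) = Z_k exp(−½⟨∂H_kB, ∂H_kB⟩). (1.64)»  [BIJ85] p. 312 [PDF 14] ll. 2–3: «where Q′ denotes the ordinary average
over k-blocks. Such a Faddeev-Popov type choice leads to the formula for the Landau gauge minimizer
H_kB = Z_k(B)⁻¹∫𝒟A δ(Q_kA − B)𝒢(∂*A) A exp(−½‖∂A‖²), (4.4.2)».

CITATION HEADER (lean-in-tree rule) — WHAT IS REPRODUCED.  Phase-2 file of the `lit-balaban` typed skeleton (HOME
`run/shared/lean/pub/lit-balaban/`), seat p16 gen 4: KNITTING of the SKELETON rows **B5.Eq1.47** ((1.46)–(1.47); tower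
`B5Eq147Landau.eq147_holds` p248304, V1 `B5Eq164LandauV1.eq147` p251591 — both untouched), **B5.Eq1.63** / **B5.Claim@29** (the
operator `H_k` and «the properties of H_kB»; torus decls of record `B5Hk163Torus.HkOp`, `B5HkOpLandauMin.hkT` — untouched),
**C1.Eq4.4.1-4.4.3** ((4.4.2) `BIJ85LandauMinimizer442.Hk`, instance `BIJ85LandauMinimizer442V1.opsV1` — untouched), **B5.Eq1.21**
((1.21) `∂*`, `Δ`) and **B5.Eq1.64**.  Carriers/objects BY NAME: V1 `LatticeFieldCalculus` (`grad`, `diverg`, `laplace`, `curl`,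
`curlAction`, `bondAvgIter`, `siteAvgIter`; r18), `BIJ85LandauForm441.LandauOps` (`projR := (N(Q′_k).map Δ).starProjection`,
`kerQk`; p11), `BIJ85LandauMinimizer442.Hk` (the (4.4.2) mean; p11), `BIJ85LandauMinimizer442V1.opsV1 P k c s` (`∂ = s·curl c`,
`∂* = s·diverg c`, `Δ = s·laplace c`, `Q_k = bondAvgIter k`, `Q′ = siteAvgIter k`; `Hk_spec_V1`, `eq_Hk_of_isMinOn_curl_V1`; p11),
`B5Eq164LandauV1` (`lan = {R∂*A = 0}`, `lanDir = {Q_kA′ = 0, R∂*A′ = 0}`, `rt47 k c s` = the (1.47) integral based at `H_kB`,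
`Zk47`, `eq164`, `eq147`; p38); tower `B5SectBStatements` (`Fld`, `Scl`, `towerM`, `Qk`, `Qsk`, `actionEta`, `deltaInt`, `fibre`,
`dirSpace`, `eta`; r02), `B5Eq147Landau` (`Dv = ∂*`, `Lap = Δ`, `Rproj`, `Lan = ker(R∘∂*)`, `rt47 = deltaInt (Q_k) (Lan) e^{−S^η}`; p16
gen 2), `B5HkOpLandauMin` (`hkT k B = pullR (HkOp (L^k) M · cplx B)` = (1.63) on the tower, `hkT_mem_landauMin`; p16 gen 2),
`B5Eq165DeltaK.landauMin` (p16 gen 2), `B5Eq117TorusCarriers` (`eK`, `eBondK`, `tV`, `tS`, `tB`, `Qk_tV`, `Qsk_tS`, `tV_grad`,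
`actionEta_tV`; p16 gen 3).  New definitions (with bodies): the isometric reindexing `tVE : BondSpace P ≃ₗᵢ Fld (towerM L Mk k)`
(Mathlib's `LinearIsometryEquiv.piLpCongrLeft` along `eBondK`; `= tV ∘ ofLp`) and its restriction `dirIso : lanDir ≃ₗᵢ dirSpace (Q_k)
(Lan)`; no `def … : Prop`, nothing is a named unproved fact.

WHAT IS PROVED (kernel, no `sorry`, standard axioms; standing range `k ≤ m + K`; every `d ≥ 1`, odd `L > 1`):
* §1 (1.21) DICTIONARIES: **`Dv_tV`** — the tower's `∂*` (adjoint of `∂^{L^k}`) of a transported field is the transported V1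
  `diverg (L^k)`; **`Lap_tS`** — `Δ = ∂*∂` likewise is `laplace (L^k)`; `Dg_tS` (gradient); `inner_tS`/`inner_tV` (the transports
  are isometric reindexings); scalings `diverg_eq_smul`, `laplace_eq_smul`, `curl_eq_mul`, `curlAction_eq_mul`.
* §2 THE LANDAU GAUGE IS ONE SUBSPACE: `projR_eq_zero_iff` (for any `LandauOps`: `Ru = 0 ↔ ⟨Δλ, u⟩ = 0 ∀λ ∈ N(Q′_k)`), the
  carrier-free forms `mem_lan_iff_sum` (V1; independent of `c, s ≠ 0`) and `tV_mem_Lan_iff_sum` (tower), hence **`map_tVE_lan`**: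
  `(lan P k c s).map tVE = Lan L Mk k` for every `c, s ≠ 0`, `tVE_mem_Lan_iff`; `Qk_tVE` ((1.18)), `map_tVE_kerQk`, and
  **`map_tVE_lanDir`**: `lanDir ↦ dirSpace (Q_k) (Lan)`.
* §3 (4.4.2) = (1.63): **`tVE_symm_eq_Hk_of_mem_landauMin`** (every Landau minimiser of the tower over `tB B`, pulled back, equals
  `Hk (opsV1 P k c s) B`), **`tVE_Hk : tVE (Hk (opsV1 P k c s) B) = hkT L Mk k (tB B)`** — the (4.4.2) Faddeev–Popov mean on V1 IS the
  closed-form (1.63) operator on the torus — `tV_Hk`, `Hk_opsV1_apply` (bond-by-bond kernel form), `Hk_opsV1_indep` (independence of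
  `c`, `s`), and **`landauMin_eq_singleton_allD`**: `landauMin k B′ = {hkT k B′}` on the tower over `T^{(k)}` for EVERY `d ≥ 1`
  (gen 2's `landauMin_eq_singleton` had `d ≥ 2`; here from p11's V1 uniqueness, no zero modes [B5] p. 30).
* §4 (1.47) IS ONE NUMBER: `dirIso`/`dirIso_coe`, `density_transport`, **`rt47_bridge`**: for `s²c² = η^d·L^{2k}`,
  `B5Eq164LandauV1.rt47 k c s B = B5Eq147Landau.rt47 L Mk k (tB B)` EXACTLY (isometries preserve subspace volumes,
  `LinearIsometryEquiv.measurePreserving`; base point `H_kB ↦ H_k(tB B)` by §3); **`rt47_bridge_printed`** (`c = L^k`, `s² = η^d`);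
  **`rt47_torus_eq164_allD`** — (1.64) on the tower for every `d ≥ 1` with p38's constant `Zk47` (gen 2's `B5Eq165DeltaK.eq164` had
  `d ≥ 2`); `rtPow_eq_const_mul_rt47` — V1 `(ST)^k e^{−S}` = `z·`(tower Landau integral), one `z > 0` for all `B`.

READINGS / HONEST SCOPE.  (a) As in gen 2/3 and in p38's file, `δ(B − Q_kA)δ_R(∂*A)dA` is the flat volume of the affine subspace
`{Q_kA = B, R∂*A = 0}` ((1.40) p. 25); the `B`-independent prefactor `z′^{(k)}|det(Δ↾N(Q′_k))|` of (1.47) is not part of either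
`rt47`.  (b) The identity `rt47_bridge` is exact only when the two quadratic forms carry the same normalisation (`s²c² = η^d·L^{2k}`);
for other `c, s` the two integrals are different Gaussian integrals (nothing claimed) — whereas the subspace (§2) and the minimiser
(§3) do not see `c, s`.  (c) U = 1, real (abelian) fields, as everywhere in [B5] Sect. 1.B–D.  Nothing here restates (1.58)–(1.62)
(momentum-space derivation of `H_k`; tree: `B5Hk160Torus`, `B5Hk163*`), and no torus or V1 statement of record is touched.

Unit `lit-balaban-p16` gen 4 (Phase-2 proof seat p16; literature-prover-lit-balaban-p16-g4-0), HOME `run/shared/lean/pub/lit-balaban/`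
(STATUS: `lit-balaban-p16/STATUS.md`), 2026-08-21.
-/

open scoped BigOperators InnerProductSpace

namespace Literature.MathematicalPhysics.QuantumFieldTheory.Balaban1983to89

namespace B5Eq147TorusBridge

open MeasureTheory
open LatticeFieldCalculus B5SectBStatements B5Eq147Landau B5Eq117TorusCarriers
open B5Prop11Plancherel (Tor fine unitVec)
open B5HierGaugeTorus (Dg Dgrad Dgrad_apply)
open B5HkOpLandauMin (hkT Qk_hkT hkT_mem_Lan hkT_mem_fibre hkT_mem_landauMin)
open B5Eq165DeltaK (landauMin mem_landauMin_iff)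
open Literature.MathematicalPhysics.QuantumFieldTheory.BalabanImbrieJaffe1984to88.BIJ85AxialPropagator411 (BondSpace PlaqSpace)
open Literature.MathematicalPhysics.QuantumFieldTheory.BalabanImbrieJaffe1984to88.BIJ85LandauForm441
open Literature.MathematicalPhysics.QuantumFieldTheory.BalabanImbrieJaffe1984to88.BIJ85LandauMinimizer442
open Literature.MathematicalPhysics.QuantumFieldTheory.BalabanImbrieJaffe1984to88.BIJ85LandauMinimizer442V1

noncomputable section

variable {P : Params} {k : ℕ}

/-! ## §0  Lattice steps under the carrier identification `eK : T^{(0)} ≃ Tor (towerM L Mk k)` -/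

/-- `eK (x − e_μ) = eK x − e_μ`. [cite: Balaban1984PropagatorsI, (1.21) p.21] -/
theorem eK_unshift (hk : k ≤ P.m + P.K) (x : Site P 0) (μ : Fin P.d) :
    eK hk (x.unshift μ) = eK hk x - unitVec (towerM P.L (Mk P k) k) μ := by
  funext ν
  simp only [eK_apply, Pi.sub_apply, unitVec, Site.unshift]
  by_cases hν : ν = μ
  · subst hν
    rw [Function.update_self, Pi.single_eq_same, map_sub, map_one]
  · rw [Function.update_of_ne hν, Pi.single_eq_of_ne hν, sub_zero]

/-- `eK⁻¹ (y − e_μ) = eK⁻¹ y − e_μ`. [cite: Balaban1984PropagatorsI, (1.21) p.21] -/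
theorem eK_symm_sub_unitVec (hk : k ≤ P.m + P.K) (y : Tor (towerM P.L (Mk P k) k)) (μ : Fin P.d) :
    (eK hk).symm (y - unitVec (towerM P.L (Mk P k) k) μ) = ((eK hk).symm y).unshift μ := by
  rw [Equiv.symm_apply_eq, eK_unshift, Equiv.apply_symm_apply]

/-- `eK⁻¹ (y + e_μ) = eK⁻¹ y + e_μ`. [cite: Balaban1984PropagatorsI, (1.4) p.18] -/
theorem eK_symm_add_unitVec (hk : k ≤ P.m + P.K) (y : Tor (towerM P.L (Mk P k) k)) (μ : Fin P.d) :
    (eK hk).symm (y + unitVec (towerM P.L (Mk P k) k) μ) = ((eK hk).symm y).shift μ := by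
  rw [Equiv.symm_apply_eq, eK_shift, Equiv.apply_symm_apply]

/-! ## §1  (1.21) on `T_η`: the divergence `∂*` and the Laplacian `Δ` are ONE operator each under transport -/

/-- **(1.21), `∂*`**: the tower's divergence `Dv` (the adjoint of `∂^{L^k}`, `B5Eq147Landau.Dv`) of a transported field is the
transported V1 divergence `diverg (L^k)` («∂*A = Σ_μ ∂*_μA_μ», backward differences with the lattice factor `η⁻¹ = L^k`).
[cite: Balaban1984PropagatorsI, (1.21) p.21] -/
theorem Dv_tV (hk : k ≤ P.m + P.K) (A : VecField P 0 ℝ) :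
    Dv P.L (Mk P k) k (tV hk A) = tS hk (diverg ((P.L : ℝ) ^ k) A) := by
  ext x
  rw [Dv_apply, tS_apply]
  simp only [diverg, tV_apply, eBondK_symm_apply, eK_symm_sub_unitVec, smul_eq_mul, Finset.mul_sum]

/-- **(1.21), `Δ`**: the tower's Laplacian `Lap = ∂*∂` of a transported gauge function is the transported V1 `laplace (L^k)`
(«Δ is η-lattice Laplace operator for scalar functions»). [cite: Balaban1984PropagatorsI, (1.21) p.21] -/
theorem Lap_tS (hk : k ≤ P.m + P.K) (lam : SiteField P 0 ℝ) :
    Lap P.L (Mk P k) k (tS hk lam) = tS hk (laplace ((P.L : ℝ) ^ k) lam) := by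
  ext x
  rw [Lap_apply, tS_apply]
  simp only [laplace, tS_apply, eK_symm_sub_unitVec, eK_symm_add_unitVec, smul_eq_mul, Finset.mul_sum]
  refine Finset.sum_congr rfl fun μ _ => ?_
  ring

/-- (1.4)/(1.20): the tower's gauge gradient `Dg = ∂^{L^k}` of a transported gauge function is the transported V1 `grad (L^k)`.
[cite: Balaban1984PropagatorsI, (1.4) p.18, (1.20) p.20] -/
theorem Dg_tS (hk : k ≤ P.m + P.K) (lam : SiteField P 0 ℝ) :
    Dg P.L (Mk P k) k (tS hk lam) = tV hk (grad ((P.L : ℝ) ^ k) lam) := by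
  rw [Dg_apply_eq, tV_grad]

/-- the transports are isometric reindexings: `⟨tS f, tS g⟩ = Σ_x f(x)g(x)`. [cite: Balaban1984PropagatorsI, (1.21) p.21] -/
theorem inner_tS (hk : k ≤ P.m + P.K) (f g : SiteField P 0 ℝ) :
    ⟪tS hk f, tS hk g⟫_ℝ = ∑ x : Site P 0, f x * g x := by
  simp only [PiLp.inner_apply, tS_apply, RCLike.inner_apply, conj_trivial]
  exact Fintype.sum_equiv (eK hk).symm _ _ fun x => by ring

/-- `⟨tV A, tV A′⟩ = Σ_b A(b)A′(b)`. [cite: Balaban1984PropagatorsI, (1.21) p.21] -/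
theorem inner_tV (hk : k ≤ P.m + P.K) (A A' : VecField P 0 ℝ) :
    ⟪tV hk A, tV hk A'⟫_ℝ = ∑ b : PBond P 0, A b * A' b := by
  simp only [PiLp.inner_apply, tV_apply, RCLike.inner_apply, conj_trivial]
  exact Fintype.sum_equiv (eBondK hk).symm _ _ fun x => by ring

/-- rescaling the lattice factor of `∂*`: `diverg c = c·diverg 1`. [cite: Balaban1984PropagatorsI, (1.21) p.21] -/
theorem diverg_eq_smul {j : ℕ} (c : ℝ) (A : VecField P j ℝ) : diverg c A = c • diverg 1 A := by
  funext x
  simp only [diverg, Pi.smul_apply, smul_eq_mul, one_mul, Finset.mul_sum]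

/-- rescaling the lattice factor of `Δ`: `laplace c = c²·laplace 1`. [cite: Balaban1984PropagatorsI, (1.21) p.21] -/
theorem laplace_eq_smul {j : ℕ} (c : ℝ) (f : SiteField P j ℝ) : laplace c f = c ^ 2 • laplace 1 f := by
  funext x
  simp only [laplace, Pi.smul_apply, smul_eq_mul, one_pow, one_mul, Finset.mul_sum]

/-! ## §2  The Landau gauge `{A : R∂*A = 0}` is ONE subspace: V1 (`projR` of [BalabanImbrieJaffe1985] (4.4.1)–(4.4.2), seats p11/p38)
= tower (`B5Eq147Landau.Lan`) under transport -/

section Generic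

variable {EA ES EP EB ES' : Type*}
  [NormedAddCommGroup EA] [InnerProductSpace ℝ EA]
  [NormedAddCommGroup ES] [InnerProductSpace ℝ ES]
  [NormedAddCommGroup EP] [InnerProductSpace ℝ EP]
  [AddCommGroup EB] [Module ℝ EB] [AddCommGroup ES'] [Module ℝ ES']

/-- «R is an orthogonal projection on the linear subspace ΔN(Q′_k)» read as a condition: `Ru = 0 ↔ ⟨Δλ, u⟩ = 0` for all
`λ ∈ N(Q′_k)` (for any instance of p11's `LandauOps`). [cite: Balaban1984PropagatorsI, p.25 (text), (1.47) p.26] -/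
theorem projR_eq_zero_iff (D : LandauOps EA ES EP EB ES') [FiniteDimensional ℝ ES] (u : ES) :
    D.projR u = 0 ↔ ∀ l : ES, D.Qp l = 0 → ⟪D.lap l, u⟫_ℝ = 0 := by
  rw [LandauOps.projR, Submodule.starProjection_apply, Submodule.coe_eq_zero,
    Submodule.orthogonalProjectionOnto_eq_zero_iff, Submodule.mem_orthogonal]
  constructor
  · intro h l hl
    exact h _ (Submodule.mem_map_of_mem (f := D.lap) ((D.mem_kerQp).2 hl))
  · intro h w hw
    obtain ⟨l, hl, rfl⟩ := Submodule.mem_map.1 hw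
    exact h l ((D.mem_kerQp).1 hl)

end Generic

/-- **the V1 Landau condition, carrier-free**: for p38's `lan P k c s = {A : R∂*A = 0}` (operators `opsV1 P k c s`, `c, s ≠ 0`),
`A ∈ lan ↔ Σ_x (∂*A)(x)(Δλ)(x) = 0` for every `λ` with `Q′_kλ = 0` — with the lattice factor `1` (the condition does not see
`c`, `s`). [cite: Balaban1984PropagatorsI, (1.47) p.26, p.25 (text)] -/
theorem mem_lan_iff_sum (k : ℕ) {c s : ℝ} (hc : c ≠ 0) (hs : s ≠ 0) (A : BondSpace P) :
    A ∈ B5Eq164LandauV1.lan P k c s ↔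
      ∀ lam : SiteField P 0 ℝ, siteAvgIter k lam = 0 →
        ∑ x : Site P 0, diverg 1 (WithLp.ofLp A) x * laplace 1 lam x = 0 := by
  rw [B5Eq164LandauV1.mem_lan, projR_eq_zero_iff]
  constructor
  · intro h lam hlam
    have h1 := h (WithLp.toLp 2 lam) (by rw [opsV1_Qp, WithLp.ofLp_toLp, hlam])
    rw [opsV1_lap, opsV1_dstar, WithLp.ofLp_toLp, inner_smul_left, inner_smul_right, laplace_eq_smul c,
      diverg_eq_smul c, WithLp.toLp_smul, WithLp.toLp_smul, inner_smul_left, inner_smul_right] at h1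
    simp only [conj_trivial, mul_eq_zero, hs, hc, pow_eq_zero_iff, ne_eq, OfNat.ofNat_ne_zero, not_false_eq_true,
      false_or] at h1
    rw [← h1]
    simp only [PiLp.inner_apply, RCLike.inner_apply, conj_trivial]
  · intro h l hl
    rw [opsV1_Qp] at hl
    have h1 := h (WithLp.ofLp l) hl
    rw [opsV1_lap, opsV1_dstar, inner_smul_left, inner_smul_right, laplace_eq_smul c, diverg_eq_smul c,
      WithLp.toLp_smul, WithLp.toLp_smul, inner_smul_left, inner_smul_right]
    simp only [conj_trivial]
    have h2 : ⟪WithLp.toLp 2 (laplace 1 (WithLp.ofLp l)), WithLp.toLp 2 (diverg 1 (WithLp.ofLp A))⟫_ℝ = 0 := by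
      rw [← h1]
      simp only [PiLp.inner_apply, RCLike.inner_apply, conj_trivial]
    rw [h2]
    ring

/-- **the tower's Landau condition, carrier-free in V1 terms**: `tV A ∈ Lan L Mk k ↔` the same sums vanish.
[cite: Balaban1984PropagatorsI, (1.47) p.26, p.25 (text)] -/
theorem tV_mem_Lan_iff_sum (hk : k ≤ P.m + P.K) (A : VecField P 0 ℝ) :
    tV hk A ∈ Lan P.L (Mk P k) k ↔
      ∀ lam : SiteField P 0 ℝ, siteAvgIter k lam = 0 →
        ∑ x : Site P 0, diverg 1 A x * laplace 1 lam x = 0 := by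
  have hL : ((P.L : ℝ) ^ k) ≠ 0 := pow_ne_zero _ (Nat.cast_ne_zero.2 P.L_pos.ne')
  rw [mem_Lan_iff_inner]
  constructor
  · intro h lam hlam
    have h1 := h (tS hk lam) (by rw [Qsk_tS, hlam, map_zero])
    rw [Dv_tV, Lap_tS, inner_tS, diverg_eq_smul ((P.L : ℝ) ^ k), laplace_eq_smul ((P.L : ℝ) ^ k)] at h1
    simp only [Pi.smul_apply, smul_eq_mul] at h1
    have h2 : ∑ x : Site P 0, (P.L : ℝ) ^ k * diverg 1 A x * (((P.L : ℝ) ^ k) ^ 2 * laplace 1 lam x)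
        = (P.L : ℝ) ^ k * ((P.L : ℝ) ^ k) ^ 2 * ∑ x : Site P 0, diverg 1 A x * laplace 1 lam x := by
      rw [Finset.mul_sum]
      exact Finset.sum_congr rfl fun x _ => by ring
    rw [h2] at h1
    simpa [hL] using h1
  · intro h l hl
    have hl' : siteAvgIter k ((tS hk).symm l) = 0 := by
      have h3 := Qsk_tS hk ((tS hk).symm l)
      rw [LinearEquiv.apply_symm_apply, hl] at h3
      exact (LinearEquiv.map_eq_zero_iff _).1 h3.symm
    have h1 := h ((tS hk).symm l) hl'
    rw [← (tS hk).apply_symm_apply l, Dv_tV, Lap_tS, inner_tS, diverg_eq_smul ((P.L : ℝ) ^ k),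
      laplace_eq_smul ((P.L : ℝ) ^ k)]
    simp only [Pi.smul_apply, smul_eq_mul]
    have h2 : ∑ x : Site P 0, (P.L : ℝ) ^ k * diverg 1 A x * (((P.L : ℝ) ^ k) ^ 2 * laplace 1 ((tS hk).symm l) x)
        = (P.L : ℝ) ^ k * ((P.L : ℝ) ^ k) ^ 2 * ∑ x : Site P 0, diverg 1 A x * laplace 1 ((tS hk).symm l) x := by
      rw [Finset.mul_sum]
      exact Finset.sum_congr rfl fun x _ => by ring
    rw [h2, h1, mul_zero]

variable (P) in
/-- the transport of the V1 bond-field EUCLIDEAN SPACE (p09/p11/p38's `BondSpace P = ℓ²(bonds of T^{(0)})`) to the tower carrier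
`Fld (towerM L Mk k)`: the isometric reindexing along `eBondK` (`= tV ∘ ofLp`). [cite: Balaban1984PropagatorsI, (1.1) p.18] -/
def tVE (hk : k ≤ P.m + P.K) : BondSpace P ≃ₗᵢ[ℝ] Fld (towerM P.L (Mk P k) k) :=
  LinearIsometryEquiv.piLpCongrLeft 2 ℝ ℝ (eBondK hk)

/-- values: `tVE A i = A (eBondK⁻¹ i)`. [cite: Balaban1984PropagatorsI, (1.1) p.18] -/
theorem tVE_apply (hk : k ≤ P.m + P.K) (A : BondSpace P) (i : Tor (towerM P.L (Mk P k) k) × Fin P.d) :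
    tVE P hk A i = A ((eBondK hk).symm i) := rfl

/-- `tVE = tV ∘ ofLp`. [cite: Balaban1984PropagatorsI, (1.1) p.18] -/
theorem tVE_eq_tV (hk : k ≤ P.m + P.K) (A : BondSpace P) : tVE P hk A = tV hk (WithLp.ofLp A) := by
  ext i
  rw [tVE_apply, tV_apply]

/-- `tVE⁻¹ A′ = toLp (tV⁻¹ A′)`. [cite: Balaban1984PropagatorsI, (1.1) p.18] -/
theorem tVE_symm_eq (hk : k ≤ P.m + P.K) (A' : Fld (towerM P.L (Mk P k) k)) :
    (tVE P hk).symm A' = WithLp.toLp 2 ((tV hk).symm A') := by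
  apply (tVE P hk).injective
  rw [LinearIsometryEquiv.apply_symm_apply, tVE_eq_tV, WithLp.ofLp_toLp, LinearEquiv.apply_symm_apply]

/-- `ofLp (tVE⁻¹ A′) = tV⁻¹ A′`. [cite: Balaban1984PropagatorsI, (1.1) p.18] -/
theorem ofLp_tVE_symm (hk : k ≤ P.m + P.K) (A' : Fld (towerM P.L (Mk P k) k)) :
    WithLp.ofLp ((tVE P hk).symm A') = (tV hk).symm A' := by
  rw [tVE_symm_eq, WithLp.ofLp_toLp]

/-- **THE TWO LANDAU GAUGES COINCIDE**: the V1 Landau subspace `{A : R∂*A = 0}` of [BalabanImbrieJaffe1985] (4.4.2) / [B5] (1.47)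
(p38's `B5Eq164LandauV1.lan`, any `c, s ≠ 0`) is carried by the reindexing `tVE` EXACTLY onto the tower's `B5Eq147Landau.Lan L Mk k`.
[cite: Balaban1984PropagatorsI, (1.47) p.26] -/
theorem map_tVE_lan (hk : k ≤ P.m + P.K) {c s : ℝ} (hc : c ≠ 0) (hs : s ≠ 0) :
    (B5Eq164LandauV1.lan P k c s).map
        ((tVE P hk).toLinearEquiv : BondSpace P →ₗ[ℝ] Fld (towerM P.L (Mk P k) k))
      = Lan P.L (Mk P k) k := by
  ext A'
  rw [Submodule.mem_map_equiv, mem_lan_iff_sum k hc hs, ← (tV hk).apply_symm_apply A', tV_mem_Lan_iff_sum hk,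
    LinearEquiv.apply_symm_apply]
  have h : WithLp.ofLp ((tVE P hk).toLinearEquiv.symm A') = (tV hk).symm A' := ofLp_tVE_symm hk A'
  rw [h]

/-- membership form: `tVE A ∈ Lan ↔ A ∈ lan`. [cite: Balaban1984PropagatorsI, (1.47) p.26] -/
theorem tVE_mem_Lan_iff (hk : k ≤ P.m + P.K) {c s : ℝ} (hc : c ≠ 0) (hs : s ≠ 0) (A : BondSpace P) :
    tVE P hk A ∈ Lan P.L (Mk P k) k ↔ A ∈ B5Eq164LandauV1.lan P k c s := by
  rw [← map_tVE_lan hk hc hs]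
  refine ⟨fun h => ?_, fun h => Submodule.mem_map_of_mem h⟩
  obtain ⟨A₀, hA₀, hEq⟩ := Submodule.mem_map.1 h
  have hAA : A₀ = A := (tVE P hk).injective hEq
  rwa [← hAA]

/-- **(1.18) through `tVE`**: `Q_k (tVE A) = tB (Q_k A)` (p11's `opsV1.Qk` = `bondAvgIter k`; gen-3 `Qk_tV`).
[cite: Balaban1984PropagatorsI, (1.18) p.20] -/
theorem Qk_tVE (hk : k ≤ P.m + P.K) (c s : ℝ) (A : BondSpace P) :
    Qk P.L (Mk P k) k (tVE P hk A) = tB ((opsV1 P k c s).Qk A) := by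
  rw [tVE_eq_tV, Qk_tV, opsV1_Qk]

/-- the constraint kernels correspond: `N(Q_k)` of V1 ↦ `N(Q_k)` of the tower. [cite: Balaban1984PropagatorsI, (1.18) p.20] -/
theorem map_tVE_kerQk (hk : k ≤ P.m + P.K) (c s : ℝ) :
    ((opsV1 P k c s).kerQk).map ((tVE P hk).toLinearEquiv : BondSpace P →ₗ[ℝ] Fld (towerM P.L (Mk P k) k))
      = LinearMap.ker (Qk P.L (Mk P k) k) := by
  ext A'
  rw [Submodule.mem_map_equiv, LandauOps.mem_kerQk, LinearMap.mem_ker, ← (tVE P hk).apply_symm_apply A',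
    Qk_tVE hk c s, LinearIsometryEquiv.apply_symm_apply]
  rw [LinearEquiv.map_eq_zero_iff]
  exact Iff.rfl

/-- **the Landau FIBRE DIRECTIONS coincide**: p38's `lanDir = {A′ : Q_kA′ = 0, R∂*A′ = 0}` ↦ the tower's
`dirSpace (Q_k) (Lan) = N(Q_k) ∩ Lan`. [cite: Balaban1984PropagatorsI, (1.64) p.29] -/
theorem map_tVE_lanDir (hk : k ≤ P.m + P.K) {c s : ℝ} (hc : c ≠ 0) (hs : s ≠ 0) :
    (B5Eq164LandauV1.lanDir P k c s).map
        ((tVE P hk).toLinearEquiv : BondSpace P →ₗ[ℝ] Fld (towerM P.L (Mk P k) k))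
      = dirSpace (Qk P.L (Mk P k) k) (Lan P.L (Mk P k) k) := by
  rw [B5Eq164LandauV1.lanDir, Submodule.map_inf _ (tVE P hk).injective, map_tVE_kerQk hk c s, map_tVE_lan hk hc hs]
  rfl

/-! ## §3  [BalabanImbrieJaffe1985] (4.4.2) `H_k` on the V1 calculus, transported, IS [Balaban1984PropagatorsI] (1.58)–(1.63) `H_k` on the torus

p. 29: «H_kB is a minimum of ½⟨∂A, ∂A⟩ on the hyperplane {A : Q_kA = B, R∂*A = 0}» — the V1 instance of the (4.4.2) Faddeev–Popov mean
(p11's `Hk (opsV1 P k c s)`) is characterised by exactly this (p11's `eq_Hk_of_isMinOn_curl_V1`); the closed-form (1.63) field transported to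
the tower (gen-2 `B5HkOpLandauMin.hkT = pullR (HkOp (L^k) Mk · cplx B)`) satisfies it (`hkT_mem_landauMin`); the two functionals
`½‖∂A‖²` differ by a positive factor only. -/

/-- rescaling the lattice factor of the curl: `curl c = c·curl 1`. [cite: Balaban1984PropagatorsI, (1.2) p.18] -/
theorem curl_eq_mul {j : ℕ} (c : ℝ) (A : VecField P j ℝ) (p : Plaq P j) : curl c A p = c * curl 1 A p := by
  simp only [curl, smul_eq_mul, one_mul]

/-- rescaling (1.3): `S_{w,c}(A) = (w·c²)·S_{1,1}(A)`. [cite: Balaban1984PropagatorsI, (1.3) p.18] -/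
theorem curlAction_eq_mul {j : ℕ} (w c : ℝ) (A : VecField P j ℝ) :
    curlAction w c A = (w * c ^ 2) * curlAction 1 1 A := by
  unfold curlAction
  simp only [curl_eq_mul c A, Real.norm_eq_abs, sq_abs, one_mul, Finset.mul_sum]
  exact Finset.sum_congr rfl fun p _ => by ring

/-- the functional «½⟨∂A, ∂A⟩» of the V1 instance `opsV1 P k c s` (`∂ = s·curl c`) is `(s²c²)·S_{1,1}`.
[cite: BalabanImbrieJaffe1985, (4.4.2) p.312] -/
theorem half_norm_curl_sq (c s : ℝ) (A : BondSpace P) :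
    (1 / 2 : ℝ) * ‖(opsV1 P k c s).curl A‖ ^ 2 = (s ^ 2 * c ^ 2) * curlAction 1 1 (WithLp.ofLp A) := by
  rw [opsV1_curl, norm_smul, mul_pow, Real.norm_eq_abs, sq_abs, PiLp.norm_sq_eq_of_L2]
  unfold curlAction
  simp only [curl_eq_mul c (WithLp.ofLp A), Real.norm_eq_abs, sq_abs, one_mul, Finset.mul_sum]
  exact Finset.sum_congr rfl fun p _ => by ring

/-- «S^η(A)» of the tower at a transported field is `(η^d·L^{2k})·S_{1,1}` (gen-3 `actionEta_tV`). [cite: Balaban1984PropagatorsI, (1.17) p.20] -/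
theorem actionEta_tVE (hk : k ≤ P.m + P.K) (A : BondSpace P) :
    actionEta P.L (Mk P k) k (tVE P hk A) = (eta P.L k ^ P.d * ((P.L : ℝ) ^ k) ^ 2) * curlAction 1 1 (WithLp.ofLp A) := by
  rw [tVE_eq_tV, actionEta_tV, curlAction_eq_mul]

/-- `η^d·L^{2k} > 0`. [cite: Balaban1984PropagatorsI, (1.18) p.20] -/
theorem eta_pow_mul_pos (P : Params) (k : ℕ) : 0 < eta P.L k ^ P.d * ((P.L : ℝ) ^ k) ^ 2 := by
  have hL : (0 : ℝ) < (P.L : ℝ) ^ k := pow_pos (Nat.cast_pos.2 P.L_pos) k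
  have hη : 0 < eta P.L k := by unfold eta; exact inv_pos.2 hL
  positivity

/-- **every Landau minimiser of the tower, pulled back to V1, IS the (4.4.2) Faddeev–Popov mean `H_kB`** — for `A′ ∈ landauMin k (tB B)`
(«a configuration … minimizing the form ½⟨∂A, ∂A⟩ under the conditions Q_kA = B, R∂*A = 0», p. 26), `tVE⁻¹A′ = Hk (opsV1 P k c s) B`:
the constraint (1.18) `Qk_tVE`, the Landau condition `tVE_mem_Lan_iff`, and minimality (the two «½‖∂A‖²» differ by the factor
`s²c²/(η^dL^{2k}) > 0`) feed p11's `eq_Hk_of_isMinOn_curl_V1`; every `d ≥ 1`, every `c, s ≠ 0`, `k ≤ m + K`.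
[cite: Balaban1984PropagatorsI, p.29 (text) «H_kB is a minimum of ½⟨∂A, ∂A⟩ on the hyperplane {A : Q_kA = B, R∂*A = 0}»] -/
theorem tVE_symm_eq_Hk_of_mem_landauMin (hk : k ≤ P.m + P.K) {c s : ℝ} (hc : c ≠ 0) (hs : s ≠ 0) {B : VecField P k ℝ}
    {A' : Fld (towerM P.L (Mk P k) k)} (hA' : A' ∈ landauMin P.L (Mk P k) k (tB B)) :
    (tVE P hk).symm A' = Hk (opsV1 P k c s) B := by
  set A₁ : BondSpace P := (tVE P hk).symm A' with hA₁def
  have h1 : tVE P hk A₁ = A' := (tVE P hk).apply_symm_apply A'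
  have hQ : (opsV1 P k c s).Qk A₁ = B := by
    apply (tB (P := P) (k := k)).injective
    rw [← Qk_tVE hk c s, h1]
    exact hA'.1.1
  have hR : (opsV1 P k c s).projR ((opsV1 P k c s).dstar A₁) = 0 := by
    rw [← B5Eq164LandauV1.mem_lan, ← tVE_mem_Lan_iff hk hc hs, h1]
    exact hA'.1.2
  have hmin : IsMinOn (fun A => (1 / 2 : ℝ) * ‖(opsV1 P k c s).curl A‖ ^ 2)
      {A | (opsV1 P k c s).Qk A = B ∧ (opsV1 P k c s).projR ((opsV1 P k c s).dstar A) = 0} A₁ := by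
    rw [isMinOn_iff]
    rintro A ⟨hAQ, hAR⟩
    have hfib : tVE P hk A ∈ fibre (Qk P.L (Mk P k) k) (Lan P.L (Mk P k) k) (tB B) :=
      ⟨by rw [Qk_tVE hk c s, hAQ], (tVE_mem_Lan_iff hk hc hs A).2 ((B5Eq164LandauV1.mem_lan A).2 hAR)⟩
    have hle := hA'.2 _ hfib
    rw [← h1, actionEta_tVE, actionEta_tVE] at hle
    show (1 / 2 : ℝ) * ‖(opsV1 P k c s).curl A₁‖ ^ 2 ≤ (1 / 2 : ℝ) * ‖(opsV1 P k c s).curl A‖ ^ 2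
    rw [half_norm_curl_sq, half_norm_curl_sq]
    exact mul_le_mul_of_nonneg_left (le_of_mul_le_mul_left hle (eta_pow_mul_pos P k)) (by positivity)
  exact eq_Hk_of_isMinOn_curl_V1 hk hc hs hQ hR hmin

/-- **(4.4.2) on V1 = (1.58)–(1.63) on the torus**: the Faddeev–Popov Gaussian mean `H_kB = Z_k(B)⁻¹∫𝒟A δ(Q_kA − B)𝒢(∂*A) A e^{−½‖∂A‖²}`
of [BalabanImbrieJaffe1985] for the V1 operators (p11), carried to the tower by the reindexing `tVE`, is Bałaban's closed-form operator
(1.63) `H_k` («This defines the operator H_kB = A», p. 28) applied to `tB B` — the tree's `B5Hk163Torus.HkOp (L^k) Mk` pulled back to the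
tower (`B5HkOpLandauMin.hkT`).  Every `d ≥ 1`, every `c, s ≠ 0`, `k ≤ m + K`. [cite: Balaban1984PropagatorsI, (1.63) p.28] -/
theorem tVE_Hk (hk : k ≤ P.m + P.K) {c s : ℝ} (hc : c ≠ 0) (hs : s ≠ 0) (B : VecField P k ℝ) :
    tVE P hk (Hk (opsV1 P k c s) B) = hkT P.L (Mk P k) k (tB B) := by
  rw [← tVE_symm_eq_Hk_of_mem_landauMin hk hc hs (hkT_mem_landauMin P.L (Mk P k) k (tB B)),
    LinearIsometryEquiv.apply_symm_apply]

/-- the same through the plain transport `tV`. [cite: Balaban1984PropagatorsI, (1.63) p.28] -/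
theorem tV_Hk (hk : k ≤ P.m + P.K) {c s : ℝ} (hc : c ≠ 0) (hs : s ≠ 0) (B : VecField P k ℝ) :
    tV hk (WithLp.ofLp (Hk (opsV1 P k c s) B)) = hkT P.L (Mk P k) k (tB B) := by
  rw [← tVE_eq_tV, tVE_Hk hk hc hs]

/-- **the (4.4.2) minimiser bond by bond through the (1.63) kernel**: `(H_kB)(b) = (pullR (HkOp (L^k) Mk · cplx (tB B)))(eBondK b)`.
[cite: BalabanImbrieJaffe1985, (4.4.2) p.312] -/
theorem Hk_opsV1_apply (hk : k ≤ P.m + P.K) {c s : ℝ} (hc : c ≠ 0) (hs : s ≠ 0) (B : VecField P k ℝ) (b : PBond P 0) :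
    Hk (opsV1 P k c s) B b = hkT P.L (Mk P k) k (tB B) (eBondK hk b) := by
  rw [← tVE_Hk hk hc hs B, tVE_apply, Equiv.symm_apply_apply]

/-- the V1 (4.4.2) minimiser does not depend on the lattice factor `c` nor on the norm weight `s` (both sides of the variational
problem scale). [cite: BalabanImbrieJaffe1985, (4.4.2) p.312] -/
theorem Hk_opsV1_indep (hk : k ≤ P.m + P.K) {c s c' s' : ℝ} (hc : c ≠ 0) (hs : s ≠ 0) (hc' : c' ≠ 0) (hs' : s' ≠ 0)
    (B : VecField P k ℝ) : Hk (opsV1 P k c s) B = Hk (opsV1 P k c' s') B :=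
  (tVE P hk).injective (by rw [tVE_Hk hk hc hs, tVE_Hk hk hc' hs'])

/-- **`landauMin k B′ = {H_kB′}` on the tower over `T^{(k)}` for EVERY `d ≥ 1`** (gen 2's `B5HkOpLandauMin.landauMin_eq_singleton` had `d ≥ 2`):
uniqueness of «the configuration minimizing ½⟨∂A, ∂A⟩ under Q_kA = B, R∂*A = 0» transported from p11's V1 uniqueness
(`Hk_spec_V1`, no zero modes [6I] p. 30). [cite: Balaban1984PropagatorsI, p.26 (text), (1.63) p.28] -/
theorem landauMin_eq_singleton_allD (hk : k ≤ P.m + P.K) (B' : Fld (Mk P k)) :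
    landauMin P.L (Mk P k) k B' = {hkT P.L (Mk P k) k B'} := by
  refine Set.eq_singleton_iff_unique_mem.2 ⟨hkT_mem_landauMin P.L (Mk P k) k B', fun A' hA' => ?_⟩
  have hB : tB ((tB (P := P) (k := k)).symm B') = B' := LinearEquiv.apply_symm_apply _ _
  rw [← hB] at hA' ⊢
  have h := tVE_symm_eq_Hk_of_mem_landauMin hk one_ne_zero one_ne_zero hA'
  rw [← (tVE P hk).apply_symm_apply A', h, tVE_Hk hk one_ne_zero one_ne_zero]

/-! ## §4  (1.47): the V1 Landau-gauge integral IS the tower's, at the printed normalisation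

«((ST)^k e^{−S})(B) = z′^{(k)}|det(Δ↾_{N(Q′_k)})|∫dA δ(B − Q_kA)δ_R(∂*A) exp(−½⟨∂A, ∂A⟩)» (1.47): p38's V1 integral `B5Eq164LandauV1.rt47 k c s`
(volume of the subspace `{A′ : Q_kA′ = 0, R∂*A′ = 0}` translated to `H_kB`) and the tower's `B5Eq147Landau.rt47 = deltaInt (Q_k) (Lan) e^{−S^η}`
(the (1.40) flat fibre measure, any base point) are related by the isometric reindexing `tVE`, which carries fibre to fibre (§2), base
point to base point (§3) and — when `s²c² = η^d·L^{2k}`, in particular at the printed `∂ = η⁻¹`-differences (`c = L^k`) with the `L²(T_η)`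
weight `s² = η^d` — density to density; an isometry preserves the subspace volumes. -/

/-- the Landau fibre directions, isometrically: p38's `lanDir` ≃ the tower's `dirSpace (Q_k) (Lan)` (restriction of `tVE`).
[cite: Balaban1984PropagatorsI, (1.64) p.29] -/
def dirIso (hk : k ≤ P.m + P.K) {c s : ℝ} (hc : c ≠ 0) (hs : s ≠ 0) :
    ↥(B5Eq164LandauV1.lanDir P k c s) ≃ₗᵢ[ℝ] ↥(dirSpace (Qk P.L (Mk P k) k) (Lan P.L (Mk P k) k)) :=
  ((tVE P hk).submoduleMap (B5Eq164LandauV1.lanDir P k c s)).trans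
    (LinearIsometryEquiv.ofEq _ _ (map_tVE_lanDir hk hc hs))

/-- values of `dirIso`: the underlying field is `tVE v`. [cite: Balaban1984PropagatorsI, (1.64) p.29] -/
theorem dirIso_coe (hk : k ≤ P.m + P.K) {c s : ℝ} (hc : c ≠ 0) (hs : s ≠ 0) (v : ↥(B5Eq164LandauV1.lanDir P k c s)) :
    ((dirIso hk hc hs v : ↥(dirSpace (Qk P.L (Mk P k) k) (Lan P.L (Mk P k) k))) : Fld (towerM P.L (Mk P k) k))
      = tVE P hk (v : BondSpace P) := rfl

/-- the two Gaussian densities agree under transport when `s²c² = η^d·L^{2k}`: `½‖∂(H_kB + v)‖² = S^η(H_k(tB B) + tVE v)`.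
[cite: Balaban1984PropagatorsI, (1.47) p.26, (1.64) p.29] -/
theorem density_transport (hk : k ≤ P.m + P.K) {c s : ℝ} (hc : c ≠ 0) (hs : s ≠ 0)
    (hsc : s ^ 2 * c ^ 2 = eta P.L k ^ P.d * ((P.L : ℝ) ^ k) ^ 2) (B : VecField P k ℝ) (v : BondSpace P) :
    (1 / 2 : ℝ) * ‖(opsV1 P k c s).curl (Hk (opsV1 P k c s) B + v)‖ ^ 2
      = actionEta P.L (Mk P k) k (hkT P.L (Mk P k) k (tB B) + tVE P hk v) := by
  rw [← tVE_Hk hk hc hs B, ← map_add, actionEta_tVE, half_norm_curl_sq, hsc]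

/-- **(1.47) IS ONE NUMBER**: for `s²c² = η^d·L^{2k}`, p38's V1 Landau-gauge integral equals the tower's EXACTLY,
`B5Eq164LandauV1.rt47 k c s B = B5Eq147Landau.rt47 L Mk k (tB B)` for every `B` (every `d ≥ 1`, `k ≤ m + K`): the isometry `dirIso`
preserves the subspace volumes (`LinearIsometryEquiv.measurePreserving`), carries `H_kB` to `H_k(tB B)` (`tVE_Hk`) and the density to the
density (`density_transport`); base-point independence on the tower side is `B5SectBStatements.deltaInt_eq`.
[cite: Balaban1984PropagatorsI, (1.47) p.26] -/
theorem rt47_bridge (hk : k ≤ P.m + P.K) {c s : ℝ} (hc : c ≠ 0) (hs : s ≠ 0)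
    (hsc : s ^ 2 * c ^ 2 = eta P.L k ^ P.d * ((P.L : ℝ) ^ k) ^ 2) (B : VecField P k ℝ) :
    B5Eq164LandauV1.rt47 k c s B = B5Eq147Landau.rt47 P.L (Mk P k) k (tB B) := by
  rw [B5Eq147Landau.rt47, deltaInt_eq _ (hkT_mem_fibre P.L (Mk P k) k (tB B))]
  unfold B5Eq164LandauV1.rt47
  have hmp := (dirIso hk hc hs).measurePreserving
  have hme : MeasurableEmbedding (dirIso hk hc hs) := (dirIso hk hc hs).toMeasurableEquiv.measurableEmbedding
  rw [← hmp.integral_comp hme]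
  refine integral_congr_ae (ae_of_all _ fun v => ?_)
  show Real.exp _ = Real.exp _
  rw [neg_mul, density_transport hk hc hs hsc B, dirIso_coe]

/-- **(1.47) at the printed normalisation** (`∂` with the lattice factor `η⁻¹ = L^k`, weight `s² = η^d`):
`rt47_{V1} k (L^k) s B = rt47_{tower} k (tB B)`. [cite: Balaban1984PropagatorsI, (1.47) p.26] -/
theorem rt47_bridge_printed (hk : k ≤ P.m + P.K) {s : ℝ} (hs2 : s ^ 2 = eta P.L k ^ P.d) (B : VecField P k ℝ) :
    B5Eq164LandauV1.rt47 k ((P.L : ℝ) ^ k) s B = B5Eq147Landau.rt47 P.L (Mk P k) k (tB B) := by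
  have hL : ((P.L : ℝ) ^ k) ≠ 0 := pow_ne_zero _ (Nat.cast_ne_zero.2 P.L_pos.ne')
  have hη : 0 < eta P.L k ^ P.d := by
    have h0 : (0 : ℝ) < (P.L : ℝ) ^ k := pow_pos (Nat.cast_pos.2 P.L_pos) k
    have h1 : 0 < eta P.L k := by unfold eta; exact inv_pos.2 h0
    positivity
  have hs : s ≠ 0 := by
    intro h
    rw [h, zero_pow two_ne_zero] at hs2
    exact hη.ne hs2
  exact rt47_bridge hk hL hs (by rw [hs2]) B

/-- **(1.64) on the tower for EVERY `d ≥ 1`** (gen 2's `B5Eq165DeltaK.eq164` had `d ≥ 2`): with p38's V1 constant `Z_k = Zk47 P k c s > 0`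
(`s²c² = η^d·L^{2k}`), `rt47_{tower} k (tB B) = Z_k·exp(−S^η(H_k(tB B)))` — p38's V1 `eq164` carried across by `rt47_bridge` and `tVE_Hk`.
[cite: Balaban1984PropagatorsI, (1.64) p.29] -/
theorem rt47_torus_eq164_allD (hk : k ≤ P.m + P.K) {c s : ℝ} (hc : c ≠ 0) (hs : s ≠ 0)
    (hsc : s ^ 2 * c ^ 2 = eta P.L k ^ P.d * ((P.L : ℝ) ^ k) ^ 2) (B : VecField P k ℝ) :
    B5Eq147Landau.rt47 P.L (Mk P k) k (tB B)
      = B5Eq164LandauV1.Zk47 P k c s * Real.exp (-actionEta P.L (Mk P k) k (hkT P.L (Mk P k) k (tB B))) := by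
  rw [← rt47_bridge hk hc hs hsc B, B5Eq164LandauV1.eq164 hk hc hs B, neg_mul, half_norm_curl_sq, hsc, ← actionEta_tVE hk,
    tVE_Hk hk hc hs]

/-- **V1 `(ST)^k e^{−S}` = z·(tower Landau integral)** — p38's V1 (1.47) `eq147` composed with `rt47_bridge`: ONE `z > 0` with
`rtPow k (e^{−S}) B = z · rt47_{tower} k (tB B)` for all `B` (`S = curlAction (s²) c`, `s²c² = η^d·L^{2k}`; every `d ≥ 1`).
[cite: Balaban1984PropagatorsI, (1.47) p.26] -/
theorem rtPow_eq_const_mul_rt47 (hk : k ≤ P.m + P.K) {c s : ℝ} (hc : c ≠ 0) (hs : s ≠ 0)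
    (hsc : s ^ 2 * c ^ 2 = eta P.L k ^ P.d * ((P.L : ℝ) ^ k) ^ 2) :
    ∃ z : ℝ, 0 < z ∧ ∀ B : VecField P k ℝ,
      B5Eq117CompositionV1.rtPow k (fun A => Real.exp (-curlAction (s ^ 2) c A)) B
        = z * B5Eq147Landau.rt47 P.L (Mk P k) k (tB B) := by
  obtain ⟨z, hz, h⟩ := B5Eq164LandauV1.eq147 (P := P) hk hc hs
  exact ⟨z, hz, fun B => by rw [h B, rt47_bridge hk hc hs hsc B]⟩

end

end B5Eq147TorusBridge

end Literature.MathematicalPhysics.QuantumFieldTheory.Balaban1983to89
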